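import Summits.BirchSwinnertonDyer.BirchSwinnertonDyer.Theorems.GenusKolyvaginAtTwoTorsionCellD0ParityFrame
import Summits.BirchSwinnertonDyer.BirchSwinnertonDyer.Theorems.GenusKolyvaginAtTwoTorsionCellSELNegTwistRows
import HarnessLib

/-!
# SEL (iso-class Selmer pair law), C1-G: the E-frame of the negative iso-class twist `E^{(−p₀M)}`

Crux R″ `RankOneTwoTorsionResidualAtTwo` (stmt-27478), LINE 49 «full_vertex», SUPPORT stub SEL
`IsoClassSelmerPairLawAtTwo`, the `C₁` half (LEAD memo `Cruxes/…/Lines/torsion_cell_full_vertex_SEL_C1_road_g36.md`,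
§0 E-FRAME; the `k`-prime version of g35's `…D0ParityFrame` for `d = −p q₁q₂`).  Setting: `E/ℚ` with rational
`2`-torsion `e₁ < e₂ < e₃`, good reduction and unit root differences off `S ∋ 2`, `Q` an iso-class set of primes
`≡ 3 (mod 4)` of even size disjoint from `S`, `p₀ ≡ 7 (mod 8)` outside `S ∪ Q` with `(−p₀/ℓ) = 1` for odd `ℓ ∈ S`,
`d = −p₀ ∏_{q∈Q} q`.  Then `d` is a square at every place of `S`, so `E` and `E^{(d)}` have the same local condition there:

* `isSquare_negTwist_adicCompletion` — `d ∈ ℚ_v^{×2}` for `v ∈ S`;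
* `frame_of_mem_selmerGroup_negTwist` — a Selmer class of `E^{(d)}` with components `(a, b)` gives the E-class
  `c_E(a, b)` in `E`'s local condition at every prime of `S` (the RELAXED group `R` of the memo);
* **`twist_mem_selmerGroup_of_frame_negTwist`** — conversely, even valuations off `S ∪ Q ∪ {p₀}`, `c_E(a,b) ∈ R`, the
  `I₀*` relations at `Q ∪ {p₀}` and `sgn a = sgn b` imply `c_{E^{(d)}}(a, b) ∈ Sel⁽²⁾(E^{(d)}/ℚ)`.

Everything is proved; no LINE 49 statement is restated; BSD is not advanced by this file alone.

## References

* [SilvermanAEC2009] J. H. Silverman, *The Arithmetic of Elliptic Curves*, 2nd ed., Prop. X.1.4, Prop. X.4.9.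
* [MazurRubin2010] B. Mazur, K. Rubin, Invent. Math. 181 (2010), Lemma 2.10, Lemma 2.11.
* [KlagsbrunMazurRubin2013] Z. Klagsbrun, B. Mazur, K. Rubin, Ann. of Math. 178 (2013), Def. 3.8.
-/

noncomputable section

open scoped Classical

namespace Summit.BirchSwinnertonDyer.BirchSwinnertonDyer.Theorems.GenusKolyvaginAtTwo.TorsionCellSEL

open WeierstrassCurve WeierstrassCurve.Affine WeierstrassCurve.Affine.Point
open Literature.NumberTheory.GaloisRepresentations Literature.NumberTheory.EllipticCurves Field
open Literature.NumberTheory.EllipticCurves.TwoDescentLocal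
open Literature.NumberTheory.EllipticCurves.KramerTwoDescent
open Literature.NumberTheory.QuadraticForms
open Summit.BirchSwinnertonDyer.BirchSwinnertonDyer.Theorems.GenusKolyvaginAtTwo.TorsionCellD0
open IsDedekindDomain NumberField Rat.HeightOneSpectrum

variable (E : WeierstrassCurve ℚ) [E.IsElliptic] {e₁ e₂ e₃ : ℚ} (S Q : Finset ℕ) {p₀ : ℕ} [hp₀ : Fact p₀.Prime]

/-! ## `d` is a square at the places of `S` -/

omit hp₀ in
/-- **`d = −p₀∏q` is a square in `ℚ_v` for every `v ∈ S`** (`−p₀`: Heegner-type splitting + `p₀ ≡ 7 (mod 8)`;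
`∏ q`: even iso-class product). [cite: KlagsbrunMazurRubin2013, Def. 3.8] [cite: SilvermanAEC2009, Prop. X.1.4] -/
theorem isSquare_negTwist_adicCompletion [hp₀ : Fact p₀.Prime] (hQ : ∀ q ∈ Q, q.Prime) (hQS : ∀ q ∈ Q, q ∉ S)
    (hQ4 : ∀ q ∈ Q, q % 4 = 3) (hk : Even Q.card) (hiso8 : ∀ q ∈ Q, ∀ q' ∈ Q, q % 8 = q' % 8)
    (hisoS : ∀ q ∈ Q, ∀ q' ∈ Q, ∀ ℓ ∈ S, (hℓ : ℓ.Prime) → ℓ ≠ 2 → haveI : Fact ℓ.Prime := ⟨hℓ⟩;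
      legendreSym ℓ ((q : ℤ) * q') = 1)
    (hp₀S : p₀ ∉ S) (hp8 : p₀ % 8 = 7)
    (hsplitp : ∀ ℓ ∈ S, (hℓ : ℓ.Prime) → ℓ ≠ 2 → haveI : Fact ℓ.Prime := ⟨hℓ⟩; legendreSym ℓ (-(p₀ : ℤ)) = 1)
    (v : HeightOneSpectrum (𝓞 ℚ)) (hvS : (primesEquiv v : ℕ) ∈ S) :
    IsSquare (algebraMap ℚ (v.adicCompletion ℚ) (-(p₀ : ℚ) * ∏ q ∈ Q, (q : ℚ))) := by
  rw [map_mul]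
  refine IsSquare.mul ?_ (isSquare_prod_adicCompletion_of_isoClass S Q hQ hQS hQ4 hiso8 hisoS (subset_refl Q) hk v hvS)
  by_cases hv2 : (primesEquiv v : ℕ) = 2
  · exact isSquare_neg_prime_adicCompletion_two (p := p₀) hp8 v hv2
  · haveI : Fact (primesEquiv v : ℕ).Prime := ⟨(primesEquiv v).2⟩
    have hℓp : (primesEquiv v : ℕ) ≠ p₀ := fun h => hp₀S (h ▸ hvS)
    exact isSquare_neg_prime_adicCompletion_odd (p := p₀) v rfl hv2 hℓp (hsplitp _ hvS (primesEquiv v).2 hv2)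

/-! ## Necessity: a Selmer class of the twist lies in the relaxed group -/

/-- **A Selmer class of `E^{(d)}` gives a RELAXED E-class**: its components `(a, b)` satisfy `E`'s local condition at
every prime of `S` (where `d` is a square). [cite: SilvermanAEC2009, Prop. X.1.4, Prop. X.4.9]
[cite: KlagsbrunMazurRubin2013, Def. 3.8] -/
theorem frame_of_mem_selmerGroup_negTwist (h : E.toAffine.SplitTwoTorsion e₁ e₂ e₃) (hQ : ∀ q ∈ Q, q.Prime)
    (hQS : ∀ q ∈ Q, q ∉ S) (hQ4 : ∀ q ∈ Q, q % 4 = 3) (hk : Even Q.card) (hiso8 : ∀ q ∈ Q, ∀ q' ∈ Q, q % 8 = q' % 8)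
    (hisoS : ∀ q ∈ Q, ∀ q' ∈ Q, ∀ ℓ ∈ S, (hℓ : ℓ.Prime) → ℓ ≠ 2 → haveI : Fact ℓ.Prime := ⟨hℓ⟩;
      legendreSym ℓ ((q : ℤ) * q') = 1)
    (hp₀S : p₀ ∉ S) (hp8 : p₀ % 8 = 7)
    (hsplitp : ∀ ℓ ∈ S, (hℓ : ℓ.Prime) → ℓ ≠ 2 → haveI : Fact ℓ.Prime := ⟨hℓ⟩; legendreSym ℓ (-(p₀ : ℤ)) = 1)
    {d : ℚ} (hd : d = -(p₀ : ℚ) * ∏ q ∈ Q, (q : ℚ)) [(E.quadraticTwist d).IsElliptic]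
    {c' : galH1Torsion (E.quadraticTwist d) 2} (hc' : c' ∈ selmerGroup (E.quadraticTwist d) 2) (a b : ℚˣ)
    (ha : kummerEquiv ℚ 2 ((E.quadraticTwist d).twoTorsionCharH1 (h.quadraticTwist d) c') = Additive.ofMul (QuotientGroup.mk a))
    (hb : kummerEquiv ℚ 2 ((E.quadraticTwist d).twoTorsionCharH1 (h.quadraticTwist d).swap₁₂ c') =
      Additive.ofMul (QuotientGroup.mk b)) :
    ∀ v : HeightOneSpectrum (𝓞 ℚ), natGenerator v ∈ S → E.twoDescentClass h a b ∈ selmerLocalKer E (v.adicCompletion ℚ) 2 := by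
  intro v hvS
  have h' := h.quadraticTwist d
  have hc_eq : c' = (E.quadraticTwist d).twoDescentClass h' a b :=
    (E.quadraticTwist d).eq_twoDescentClass_of_kummerEquiv_eq h' a b ha hb
  have hsq := isSquare_negTwist_adicCompletion S Q hQ hQS hQ4 hk hiso8 hisoS hp₀S hp8 hsplitp v hvS
  rw [← hd] at hsq
  have hloc' := ((mem_selmerGroup_iff _ _ _).mp hc').1 v
  rw [hc_eq] at hloc'
  exact (E.twoDescentClass_quadraticTwist_mem_selmerLocalKer_iff (v.adicCompletion ℚ)
    (charZero_of_injective_algebraMap (algebraMap ℚ _).injective) h hsq a b).mp hloc'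

/-! ## Sufficiency: the frame conditions give a Selmer class of the twist -/

omit hp₀ in
/-- The `I₀*` relations at a twisting prime are additive in the pair. [folklore] -/
private theorem rel_mul' {q : ℕ} [Fact q.Prime] {κ κ' δ₁ δ₂ : ZMod 2} {a b a' b' : ℚ} (ha : a ≠ 0) (hb : b ≠ 0)
    (ha' : a' ≠ 0) (hb' : b' ≠ 0)
    (h1 : qrBit q a = parityBit q a * κ + parityBit q b * δ₁ ∧ qrBit q b = parityBit q a * δ₂ + parityBit q b * κ')
    (h2 : qrBit q a' = parityBit q a' * κ + parityBit q b' * δ₁ ∧ qrBit q b' = parityBit q a' * δ₂ + parityBit q b' * κ') :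
    qrBit q (a * a') = parityBit q (a * a') * κ + parityBit q (b * b') * δ₁ ∧
      qrBit q (b * b') = parityBit q (a * a') * δ₂ + parityBit q (b * b') * κ' := by
  rw [qrBit_mul q ha ha', qrBit_mul q hb hb', parityBit_mul ha ha', parityBit_mul hb hb', h1.1, h1.2, h2.1, h2.2]
  constructor <;> ring

/-- **`Sel⁽²⁾(E^{(d)})` from the frame conditions**, `d = −p₀∏_{q∈Q} q`: for `a, b ∈ ℚˣ` with even valuations off
`S ∪ Q ∪ {p₀}`, `c_E(a,b)` in `E`'s local condition at the primes of `S`, the `I₀*` relations at every `q ∈ Q` and at `p₀`,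
and `sgn a = sgn b`, the class `c_{E^{(d)}}(a, b)` is Selmer.
[cite: SilvermanAEC2009, Prop. X.1.4, Prop. X.4.9] [cite: MazurRubin2010, Lemma 2.10, Lemma 2.11] -/
theorem twist_mem_selmerGroup_of_frame_negTwist (h : E.toAffine.SplitTwoTorsion e₁ e₂ e₃) (h2S : 2 ∈ S)
    (h12 : e₁ < e₂) (h23 : e₂ < e₃)
    (hgood : ∀ ℓ : ℕ, (hℓ : ℓ.Prime) → ℓ ∉ S → haveI : Fact ℓ.Prime := ⟨hℓ⟩;
      padicValRat ℓ (e₁ - e₂) = 0 ∧ padicValRat ℓ (e₁ - e₃) = 0 ∧ padicValRat ℓ (e₂ - e₃) = 0)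
    (hN : ∀ ℓ : ℕ, ℓ.Prime → ℓ ∉ S → ¬ ℓ ∣ E.conductorNorm ℤ)
    (hQ : ∀ q ∈ Q, q.Prime) (hQS : ∀ q ∈ Q, q ∉ S) (hQ4 : ∀ q ∈ Q, q % 4 = 3) (hk : Even Q.card)
    (hiso8 : ∀ q ∈ Q, ∀ q' ∈ Q, q % 8 = q' % 8)
    (hisoS : ∀ q ∈ Q, ∀ q' ∈ Q, ∀ ℓ ∈ S, (hℓ : ℓ.Prime) → ℓ ≠ 2 → haveI : Fact ℓ.Prime := ⟨hℓ⟩;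
      legendreSym ℓ ((q : ℤ) * q') = 1)
    (hp₀S : p₀ ∉ S) (hp₀Q : p₀ ∉ Q) (hp8 : p₀ % 8 = 7)
    (hsplitp : ∀ ℓ ∈ S, (hℓ : ℓ.Prime) → ℓ ≠ 2 → haveI : Fact ℓ.Prime := ⟨hℓ⟩; legendreSym ℓ (-(p₀ : ℤ)) = 1)
    {d : ℚ} (hd : d = -(p₀ : ℚ) * ∏ q ∈ Q, (q : ℚ)) [(E.quadraticTwist d).IsElliptic] (a b : ℚˣ)
    (hsupp : ∀ ℓ : ℕ, (hℓ : ℓ.Prime) → ℓ ∉ S → ℓ ∉ Q → ℓ ≠ p₀ → haveI : Fact ℓ.Prime := ⟨hℓ⟩;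
      parityBit ℓ (a : ℚ) = 0 ∧ parityBit ℓ (b : ℚ) = 0)
    (hloc : ∀ v : HeightOneSpectrum (𝓞 ℚ), natGenerator v ∈ S →
      E.twoDescentClass h a b ∈ selmerLocalKer E (v.adicCompletion ℚ) 2)
    (hrel : ∀ q : ℕ, (hq : q.Prime) → (q ∈ Q ∨ q = p₀) → haveI : Fact q.Prime := ⟨hq⟩;
      qrBit q (a : ℚ) = parityBit q (a : ℚ) * (qrBit q d + qrBit q (e₂ - e₁)) +
          parityBit q (b : ℚ) * qrBit q ((e₁ - e₂) * (e₁ - e₃)) ∧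
        qrBit q (b : ℚ) = parityBit q (a : ℚ) * qrBit q ((e₂ - e₁) * (e₂ - e₃)) +
          parityBit q (b : ℚ) * (qrBit q d + qrBit q (e₁ - e₂)))
    (hsign : signBit (a : ℚ) = signBit (b : ℚ)) :
    (E.quadraticTwist d).twoDescentClass (h.quadraticTwist d) a b ∈ selmerGroup (E.quadraticTwist d) 2 := by
  have h' := h.quadraticTwist d
  have hp0 : (0 : ℚ) < p₀ := by exact_mod_cast hp₀.out.pos
  have hp0' : (p₀ : ℚ) ≠ 0 := hp0.ne'
  have hQ0 : ∀ q ∈ Q, (q : ℚ) ≠ 0 := fun q hq => by exact_mod_cast (hQ q hq).ne_zero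
  have hP0 : ∏ q ∈ Q, (q : ℚ) ≠ 0 := Finset.prod_ne_zero_iff.mpr hQ0
  have hPpos : (0 : ℚ) < ∏ q ∈ Q, (q : ℚ) := Finset.prod_pos fun q hq => by exact_mod_cast (hQ q hq).pos
  have hdneg : d < 0 := by rw [hd]; nlinarith
  have hd0 : d ≠ 0 := hdneg.ne
  have hp4 : p₀ % 4 = 3 := by omega
  -- valuation of `d` at the primes
  have hvdQ : ∀ q ∈ Q, (hq : q.Prime) → haveI : Fact q.Prime := ⟨hq⟩; padicValRat q d = 1 := by
    intro q hq hqp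
    haveI : Fact q.Prime := ⟨hqp⟩
    have hqp₀ : q ≠ p₀ := fun e => hp₀Q (e ▸ hq)
    rw [hd, padicValRat.mul (neg_ne_zero.mpr hp0') hP0, padicValRat.neg, padicValRat_prod_primes hQ q, if_pos hq,
      show (p₀ : ℚ) = ((p₀ : ℕ) : ℚ) from rfl, padicValRat.of_nat, padicValNat_primes hqp₀]
    rfl
  have hvdp : padicValRat p₀ d = 1 := by
    rw [hd, padicValRat.mul (neg_ne_zero.mpr hp0') hP0, padicValRat.neg, padicValRat_prod_primes hQ p₀, if_neg hp₀Q,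
      show (p₀ : ℚ) = ((p₀ : ℕ) : ℚ) from rfl, padicValRat.of_nat, padicValNat_self]
    rfl
  -- the twisting primes: torsion normalisation, then both components are squares
  have twist_case : ∀ (q : ℕ) [Fact q.Prime] (v : HeightOneSpectrum (𝓞 ℚ)), (primesEquiv (R := 𝓞 ℚ) v : ℕ) = q →
      q ≠ 2 → q ∉ S → padicValRat q d = 1 →
      (qrBit q (a : ℚ) = parityBit q (a : ℚ) * (qrBit q d + qrBit q (e₂ - e₁)) +
          parityBit q (b : ℚ) * qrBit q ((e₁ - e₂) * (e₁ - e₃)) ∧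
        qrBit q (b : ℚ) = parityBit q (a : ℚ) * qrBit q ((e₂ - e₁) * (e₂ - e₃)) +
          parityBit q (b : ℚ) * (qrBit q d + qrBit q (e₁ - e₂))) →
      (E.quadraticTwist d).twoDescentClass h' a b ∈ selmerLocalKer (E.quadraticTwist d) (v.adicCompletion ℚ) 2 := by
    intro q _ v hvq hq2 hqS hqd hrel_ab
    obtain ⟨g12, g13, g23⟩ := hgood q Fact.out hqS
    obtain ⟨t₁, t₂, ht, hpa, hpb⟩ :=
      E.exists_torsionPair_quadraticTwist_parityBit_mul_eq_zero h (d := d) hqd g12 g13 g23 a b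
    have hrel_t := E.qrBit_rel_quadraticTwist_of_mem_selmerGroup h hqd g12 g13 g23 ht t₁ t₂
      ((E.quadraticTwist d).kummerEquiv_twoTorsionCharH1_twoDescentClass h' t₁ t₂)
      ((E.quadraticTwist d).kummerEquiv_twoTorsionCharH1_swap_twoDescentClass h' t₁ t₂)
    obtain ⟨r1, r2⟩ := rel_mul' (q := q) a.ne_zero b.ne_zero t₁.ne_zero t₂.ne_zero hrel_ab hrel_t
    rw [hpa, hpb, zero_mul, zero_mul, zero_add] at r1 r2
    have hsqa : IsSquare (algebraMap ℚ (v.adicCompletion ℚ) ((a * t₁ : ℚˣ) : ℚ)) := by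
      rw [Units.val_mul]
      exact isSquare_algebraMap_adicCompletion_of_bits v hvq hq2 (mul_ne_zero a.ne_zero t₁.ne_zero) hpa r1
    have hsqb : IsSquare (algebraMap ℚ (v.adicCompletion ℚ) ((b * t₂ : ℚˣ) : ℚ)) := by
      rw [Units.val_mul]
      exact isSquare_algebraMap_adicCompletion_of_bits v hvq hq2 (mul_ne_zero b.ne_zero t₂.ne_zero) hpb r2
    have hmem := twoDescentClass_mem_selmerLocalKer_of_isSquare (E.quadraticTwist d) h' _
      (charZero_of_injective_algebraMap (algebraMap ℚ _).injective) (a * t₁) (b * t₂) hsqa hsqb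
    rw [twoDescentClass_mul (E.quadraticTwist d) h'] at hmem
    have ht_loc := ((mem_selmerGroup_iff _ _ _).mp ht).1 v
    have := sub_mem hmem ht_loc
    rwa [add_sub_cancel_right] at this
  rw [mem_selmerGroup_iff]
  refine ⟨fun v => ?_, fun w => ?_⟩
  · by_cases hvS : natGenerator v ∈ S
    · -- places of `S`: `d` is a square, the two curves have the same local condition
      have hsq := isSquare_negTwist_adicCompletion S Q hQ hQS hQ4 hk hiso8 hisoS hp₀S hp8 hsplitp v hvS
      rw [← hd] at hsq
      exact (E.twoDescentClass_quadraticTwist_mem_selmerLocalKer_iff (v.adicCompletion ℚ)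
        (charZero_of_injective_algebraMap (algebraMap ℚ _).injective) h hsq a b).mpr (hloc v hvS)
    · have hℓ := prime_natGenerator v
      have hℓ2 : natGenerator v ≠ 2 := fun h2 => hvS (h2 ▸ h2S)
      by_cases hvp : natGenerator v = p₀
      · exact twist_case p₀ v hvp (hvp ▸ hℓ2) hp₀S hvdp (hrel p₀ hp₀.out (Or.inr rfl))
      by_cases hvQ : natGenerator v ∈ Q
      · haveI : Fact (natGenerator v).Prime := ⟨hℓ⟩
        exact twist_case (natGenerator v) v rfl hℓ2 hvS (hvdQ _ hvQ hℓ) (hrel _ hℓ (Or.inl hvQ))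
      -- a good prime of the twist
      haveI : Fact (natGenerator v).Prime := ⟨hℓ⟩
      obtain ⟨hpa, hpb⟩ := hsupp (natGenerator v) hℓ hvS hvQ hvp
      obtain ⟨m, hm0, hmd, hma⟩ := exists_unit_int_rep (ℓ := natGenerator v) a hpa
      obtain ⟨m', hm0', hmd', hmb⟩ := exists_unit_int_rep (ℓ := natGenerator v) b hpb
      have hgoodv : (E.quadraticTwist d).HasGoodReductionAt v := by
        by_contra hbad
        have hdvd := ((E.quadraticTwist d).dvd_conductorNorm_iff v).mpr hbad
        have hdZ0 : (-(p₀ : ℤ) * ∏ q ∈ Q, (q : ℤ)) ≠ 0 := by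
          refine mul_ne_zero (neg_ne_zero.mpr (by exact_mod_cast hp₀.out.ne_zero)) ?_
          exact Finset.prod_ne_zero_iff.mpr fun q hq => by exact_mod_cast (hQ q hq).ne_zero
        have hndvd : ¬ ((natGenerator v : ℕ) : ℤ) ∣ (-(p₀ : ℤ) * ∏ q ∈ Q, (q : ℤ)) := by
          rw [neg_mul, dvd_neg]
          intro hd'
          have hpr : Prime ((natGenerator v : ℕ) : ℤ) := Nat.prime_iff_prime_int.mp hℓ
          rcases hpr.dvd_or_dvd hd' with h1 | h1
          · exact hvp ((Nat.prime_dvd_prime_iff_eq hℓ hp₀.out).mp (Int.natCast_dvd_natCast.mp h1))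
          · obtain ⟨q, hqQ, hq⟩ := (Prime.dvd_finsetProd_iff hpr _).mp h1
            exact hvQ (((Nat.prime_dvd_prime_iff_eq hℓ (hQ q hqQ)).mp (Int.natCast_dvd_natCast.mp hq)) ▸ hqQ)
        have hnot := not_dvd_conductorNorm_quadraticTwist_of_not_dvd E hℓ hℓ2 (hN _ hℓ hvS) hdZ0 hndvd
        rw [show (((-(p₀ : ℤ) * ∏ q ∈ Q, (q : ℤ) : ℤ)) : ℚ) = d by rw [hd]; push_cast; ring] at hnot
        exact hnot hdvd
      exact (E.quadraticTwist d).twoDescentClass_mem_selmerLocalKer_of_mk_eq_intCast h' v hℓ2 hgoodv a b m m' hm0 hm0'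
        hma hmb hmd hmd'
  · -- the real place: both components have the same sign
    rcases lt_or_gt_of_ne a.ne_zero with han | hap
    · have hbn : (b : ℚ) < 0 := by
        have : signBit (b : ℚ) = 1 := by rw [← hsign, signBit, if_pos han]
        by_contra hb'
        rw [signBit, if_neg hb'] at this
        exact zero_ne_one this
      refine twoDescentClass_mem_selmerLocalKer_of_isSquare_T₂ (E.quadraticTwist d) h' _
        (charZero_of_injective_algebraMap (algebraMap ℚ _).injective) a b ?_ ?_
      · refine isSquare_algebraMap_completion_of_pos w (mul_pos_of_neg_of_neg han ?_)
        rw [← mul_sub]; exact mul_neg_of_neg_of_pos hdneg (by linarith)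
      · refine isSquare_algebraMap_completion_of_pos w (mul_pos_of_neg_of_neg hbn ?_)
        rw [← mul_sub, ← mul_sub, show d * (e₂ - e₁) * (d * (e₂ - e₃)) = d ^ 2 * ((e₂ - e₁) * (e₂ - e₃)) by ring]
        exact mul_neg_of_pos_of_neg (by positivity) (mul_neg_of_pos_of_neg (by linarith) (by linarith))
    · have hbp : 0 < (b : ℚ) := by
        have : signBit (b : ℚ) = 0 := by rw [← hsign, signBit, if_neg (not_lt.mpr hap.le)]
        exact (signBit_eq_zero_iff b.ne_zero).mp this
      exact twoDescentClass_mem_selmerLocalKer_of_isSquare (E.quadraticTwist d) h' _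
        (charZero_of_injective_algebraMap (algebraMap ℚ _).injective) a b
        (isSquare_algebraMap_completion_of_pos w hap) (isSquare_algebraMap_completion_of_pos w hbp)

end Summit.BirchSwinnertonDyer.BirchSwinnertonDyer.Theorems.GenusKolyvaginAtTwo.TorsionCellSEL

end
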